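import Literature.NumberTheory.EllipticCurves.GreenbergVatsal2000.ResidualSelmerGroups
import HarnessLib

/-!
# Greenberg–Vatsal 2000, §2 p. 28 with p. 30: the cohomology sequence of `0 → Φ → E[p] → Ψ → 0`
# over `ℚ_∞` is exact on the right (`H²(ℚ_Σ/ℚ_∞, Φ) = 0`) — the LIFTING input of display (16)

HONEST FRAMING (BSD rank-`≤ 1` residual cell `b2b-bsdres`, home
`run/shared/lean/b2b/bsd-rank1-residual/`, unit `b2b-bsdres-eisenstein-p2`, class X2): the cell
deletes the COMBINATION-SHAPED residual classes of the rank-`≤ 1` BSD formula from PUBLISHED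
theorems only and TYPES the construction-shaped ones; this is not "finishing BSD". This file records
ONE published statement as a named fact (`def … : Prop`, nothing asserted; D-0014/D-0026) — a
READING FACT: the right exactness of Greenberg–Vatsal's display on p. 28, whose printed
justification is the vanishing `H²(ℚ_Σ/ℚ_∞, Φ) = 0` of p. 30 (Ferrero–Washington + Prop. (2.5) +
[Gre99] Prop. 4 — character-theoretic, independent of `E`). It is VERBATIM the type of the cell's
typed input `Summit.…X2.GVLiftingInput` (gen 17) in the Literature twin vocabulary of
`ResidualSelmerGroups.lean` (definitional bridge: `Summits/…/X2/GreenbergVatsalInputsOfFacts.lean`),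
i.e. one of the two remaining printed inputs of the cell's kernel proof of GV Thm. (1.3) at a
multiplicative prime (flag `GV00-mult-asserted`).

## Citation header (held text arXiv:math/9906215 = `paper:arxiv-math_9906215`, p0051 = p. 28,
## p0053 = p. 30)

* p. 28: "We will assume that the ramified character is even, and so the unramified character is
  odd. … Thus, we may assume for our purpose that `φ` is ramified and even, `ψ` is unramified and
  odd. … Now `H⁰(ℚ_∞, Ψ) = 0`. Later we will show that `H²(ℚ_Σ/ℚ_∞, Φ) = 0`. Therefore, we have an
  exact sequence `0 → H¹(ℚ_Σ/ℚ_∞, Φ) → H¹(ℚ_Σ/ℚ_∞, E[p]) →ε H¹(ℚ_Σ/ℚ_∞, Ψ) → 0`. Now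
  `S^{Σ₀}_{E[p]}(ℚ_∞) = ker(H¹(ℚ_Σ/ℚ_∞, E[p]) → H¹(I_p, Ψ))`. Hence `im(·) ⊂ S^{Σ₀}_{E[p]}(ℚ_∞) =
  ε⁻¹(U)`, where `U = ker(H¹(ℚ_Σ/ℚ_∞, Ψ) → H¹(I_p, Ψ))`."
* p. 30: the proof that `H²(ℚ_Σ/ℚ_∞, Φ) = 0` (Ferrero–Washington, proposition (2.5), [Gre99]
  Prop. 4).

## The tree's vocabulary (no new definition)

`E/ℚ` on a globally minimal model, `p` odd, `Φ₀ ≤ E[p]` a rational line RAMIFIED at `p` and EVEN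
(`IsRationalLine`, `¬ LineUnramifiedAt`, `LineEven`; GV's `φ` ramified and even), `κ` the
cyclotomic `ℤ_p`-extension (`ℚ_∞ = ℚ̄^{ker κ}`), `S₀ = Σ₀` a finite set of places not above `p`
containing the bad places `≠ p` (p. 23 "`Σ = Σ₀ ∪ {p, ∞}`"); the groups of p. 28 as filed in
`ResidualSelmerGroups.lean`: `residualTorsionH1` = `H¹(ℚ_Σ/ℚ_∞, E[p])`, `residualQuotSelmer` = the
elements of `U` inside `H¹(ℚ_Σ/ℚ_∞, Ψ)` (`S^{Σ₀}_Ψ(ℚ_∞) = H¹_unr`, p. 29), `residualEpsilon` = `ε`.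
The statement filed is the surjectivity of `ε` onto `H¹(ℚ_Σ/ℚ_∞, Ψ) ⊇ U`, read on `U`: every element
of `U` lifts to `H¹(ℚ_Σ/ℚ_∞, E[p])`.
-/

set_option autoImplicit false

noncomputable section

open scoped Classical AddSubgroup

open NumberField IsDedekindDomain Field WeierstrassCurve
open Literature.NumberTheory.EllipticCurves Literature.NumberTheory.GaloisRepresentations
  Literature.NumberTheory.EllipticCurves.Rank1Residual

namespace Literature.NumberTheory.EllipticCurves.GreenbergVatsal2000

/-- **Greenberg–Vatsal 2000, §2 p. 28 (with p. 30): `ε : H¹(ℚ_Σ/ℚ_∞, E[p]) → H¹(ℚ_Σ/ℚ_∞, Ψ)` is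
onto — every class of `U` lifts.** p. 28: "Later we will show that `H²(ℚ_Σ/ℚ_∞, Φ) = 0`. Therefore,
we have an exact sequence `0 → H¹(ℚ_Σ/ℚ_∞, Φ) → H¹(ℚ_Σ/ℚ_∞, E[p]) →ε H¹(ℚ_Σ/ℚ_∞, Ψ) → 0`. … where
`U = ker(H¹(ℚ_Σ/ℚ_∞, Ψ) → H¹(I_p, Ψ))`" (under "`φ` is ramified and even, `ψ` is unramified and
odd"; `H² = 0` proved on p. 30 from Ferrero–Washington, Prop. (2.5) and [Gre99] Prop. 4).
TRANSCRIPTION: for `E/ℚ` on a globally minimal model, `p ≠ 2`, `κ` the cyclotomic `ℤ_p`-extension,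
`Φ₀ ≤ E[p]` a rational line ramified at `p` and even, `S₀ ∌ p` finite containing the bad places
`≠ p`: every element of `residualQuotSelmer` (`U ∩ H¹(ℚ_Σ/ℚ_∞, Ψ)`) is `ε x` for some
`x ∈ residualTorsionH1` (`H¹(ℚ_Σ/ℚ_∞, E[p])`). This is definitionally the cell's typed input
`X2.GVLiftingInput W p κ S₀ Φ₀ hΦ` (gen 17). Named reading-fact; nothing asserted.
-- TODO(general form): GV prove `H²(ℚ_Σ/ℚ_∞, Φ) = 0` (p. 30), i.e. surjectivity of `ε` onto all of
-- `H¹(ℚ_Σ/ℚ_∞, Ψ)`; only the consequence on `U` (the lifting used in display (16)) is filed.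
[cite: GreenbergVatsal2000, §2 p. 28 (exact sequence for H¹(ℚ_Σ/ℚ_∞, ·)) with p. 30 (H²(ℚ_Σ/ℚ_∞, Φ) = 0)] -/
def residualEpsilon_surjOn_of_lineRamifiedEven : Prop :=
  ∀ (W : WeierstrassCurve ℚ) [W.IsGloballyMinimal] [W.IsElliptic] (p : ℕ) [Fact p.Prime]
    (κ : ZpExtension ℚ p) (S₀ : Finset (HeightOneSpectrum (𝓞 ℚ)))
    (Φ₀ : AddSubgroup (W.geomTorsion (p : ℤ))) (hΦ : IsRationalLine W p Φ₀),
    p ≠ 2 → κ.IsCyclotomic → ¬ LineUnramifiedAt W p Φ₀ → LineEven W p Φ₀ →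
    (∀ v ∈ S₀, ((p : ℕ) : 𝓞 ℚ) ∉ v.asIdeal) →
    (∀ v : HeightOneSpectrum (𝓞 ℚ), v ∉ S₀ → ((p : ℕ) : 𝓞 ℚ) ∉ v.asIdeal →
      W.HasGoodReductionAt v) →
    ∀ s ∈ residualQuotSelmer W p κ S₀ Φ₀ hΦ, ∃ x ∈ residualTorsionH1 W p κ S₀,
      residualEpsilon W p κ Φ₀ hΦ x = s

end Literature.NumberTheory.EllipticCurves.GreenbergVatsal2000

end
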